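import Literature.MathematicalPhysics.QuantumFieldTheory.YangMillsOS
import HarnessLib

/-!
# `FemtoCurvatureTwoPointC` — the `∀ G` form of the nearest-neighbour floor NN is false (degenerate gauge group)

Negative-side lemma for crux `Summit.QuantumFields.YangMills.Theses.LangevinControlUV.FemtoCurvatureTwoPointC`
(item stmt-QuantumFields-16204), line `conditional-covariance-floor`, skeleton v2, stub `stub_nearestNeighbourFloor` (NN).

The registered NN quantifies over EVERY compact group `G` carrying a faithful continuous unitary lattice
representation `r : LatticeRep G` — unlike its sibling stubs it does not assume `IsCompactSimpleLieGroup G`.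
The trivial group qualifies (with its one-dimensional trivial representation, faithful on a
one-point group), and for it every plaquette field `U ↦ N − Re tr r.ρ(U_{x,ij})` vanishes identically
(`plaqField_eq_zero_of_subsingleton`), so every plaquette–plaquette covariance under Wilson's measure is `0`
(`plaqCov_eq_zero_of_subsingleton`) while the asserted floor `c₁/β²` is positive at `β = max β₂ 1`:
`not_nearestNeighbourFloor_allGroups`. (Finite gauge groups fail too — there the covariance is `O(e^{−cβ})` —
but the one-point group is the `rfl`-level witness.)

Consequence for the line: NN must carry the hypothesis `IsCompactSimpleLieGroup G →` (as R, TU, LU, V′, Flo′,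
Dec′ do); the composition `afProfilesCore_of_floor` instantiates NN only under that hypothesis (`hNN G r` with
`hG : IsCompactSimpleLieGroup G` in scope), so the corrected stub slots in as `hNN G hG r`.
-/

noncomputable section

open MeasureTheory
open Literature.MathematicalPhysics.QuantumFieldTheory

namespace Summit.QuantumFields.YangMills.Theorems.FemtoCurvatureTwoPointC.Negative.NearestNeighbourFloorDegenerate

section Subsingleton

variable {G : Type} [Group G] [TopologicalSpace G] [Subsingleton G]

/-- On a one-point gauge group every plaquette holonomy is `1`, so the plaquette field
`U ↦ N − Re tr r.ρ(U_{x,ij})` of any lattice representation vanishes identically. [folklore] -/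
theorem plaqField_eq_zero_of_subsingleton (r : LatticeRep G) {L : ℕ} (x : Fin 4 → ZMod L) (i j : Fin 4)
    (U : GaugeConfig 4 L G) : (r.N : ℝ) - (r.ρ (plaquetteHolonomy U x i j)).trace.re = 0 := by
  rw [Subsingleton.elim (plaquetteHolonomy U x i j) 1, map_one, Matrix.trace_one]
  simp

/-- Hence, on a one-point gauge group, every plaquette–plaquette "covariance" functional
`E(P_x^{ij} P_y^{kl}) − E(P_x^{ij}) E(P_y^{kl})` built from ANY functional `E` vanishing at `0` (e.g. a Wilson
expectation) is `0`. [folklore] -/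
theorem plaqCov_eq_zero_of_subsingleton (r : LatticeRep G) {L : ℕ}
    (P : (Fin 4 → ZMod L) → Fin 4 → Fin 4 → GaugeConfig 4 L G → ℝ) (E : (GaugeConfig 4 L G → ℝ) → ℝ)
    (hP : P = fun x i j U => (r.N : ℝ) - (r.ρ (plaquetteHolonomy U x i j)).trace.re)
    (hE : E (fun _ => 0) = 0) (x y : Fin 4 → ZMod L) (i j k l : Fin 4) :
    E (fun U => P x i j U * P y k l U) - E (P x i j) * E (P y k l) = 0 := by
  have h0 : ∀ (z : Fin 4 → ZMod L) (a b : Fin 4), P z a b = fun _ => 0 := fun z a b => by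
    funext U
    rw [hP]
    exact plaqField_eq_zero_of_subsingleton r z a b U
  have h1 : (fun U => P x i j U * P y k l U) = fun _ => 0 := by
    funext U
    rw [h0 x i j, h0 y k l]
    simp
  rw [h1, h0 x i j, h0 y k l, hE]
  simp

end Subsingleton

/-- **The registered `∀ G` form of NN (`stub_nearestNeighbourFloor`, skeleton v2 of line
`conditional-covariance-floor`) is false.** Witness: the one-point group with its trivial one-dimensional representation, `L₀ = L = 8`,
`β = max β₂ 1`; the covariance vanishes (`plaqCov_eq_zero_of_subsingleton`) while `0 < c₁/β²`. The statement refuted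
is the registered signature verbatim. [folklore] -/
theorem not_nearestNeighbourFloor_allGroups :
    ¬ (∀ (G : Type) [Group G] [TopologicalSpace G] [IsTopologicalGroup G] [CompactSpace G]
        [MeasurableSpace G] [BorelSpace G] (r : LatticeRep G),
      ∀ L₀ : ℕ, ∃ (β₂ c₁ : ℝ), 0 < c₁ ∧
        ∀ (L : ℕ) [NeZero L] (β : ℝ), 8 ≤ L → L ≤ L₀ → β₂ ≤ β →
          ∀ (P : (Fin 4 → ZMod L) → Fin 4 → Fin 4 → GaugeConfig 4 L G → ℝ)
            (E : (GaugeConfig 4 L G → ℝ) → ℝ),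
            (P = fun x i j U => (r.N : ℝ) - (r.ρ (plaquetteHolonomy U x i j)).trace.re) →
            (E = fun F => wilsonExpectation r.ρ β F) →
            c₁ / β ^ 2 ≤
              E (fun U => P 0 0 1 U * P (Pi.single (2 : Fin 4) ((1 : ℕ) : ZMod L)) 0 1 U)
                - E (P 0 0 1) * E (P (Pi.single (2 : Fin 4) ((1 : ℕ) : ZMod L)) 0 1)) := by
  intro h
  -- the one-point group with its trivial one-dimensional representation (faithful: one element)
  obtain ⟨β₂, c₁, hc₁, h⟩ := h Unit
    { N := 1, ρ := 1, continuous := continuous_const, injective := fun a b _ => Subsingleton.elim a b,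
      mem_unitary := fun _ => by simp } 8
  have key := h 8 (max β₂ 1) le_rfl le_rfl (le_max_left _ _) _ _ rfl rfl
  rw [plaqCov_eq_zero_of_subsingleton _ _ _ rfl (by simp [wilsonExpectation])] at key
  have : 0 < c₁ / max β₂ 1 ^ 2 := by positivity
  linarith

/-- **The corrected NN is consistent with the witness**: the one-point group is not a compact simple Lie group
(it is not even nontrivial), so adding the hypothesis `IsCompactSimpleLieGroup G` — carried by every other stub of
the line — removes the counterexample. [folklore] -/
theorem not_isCompactSimpleLieGroup_unit : ¬ IsCompactSimpleLieGroup Unit := fun h => by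
  obtain ⟨a, b, hab⟩ := h.1.2.1
  exact hab (Subsingleton.elim _ _)

end Summit.QuantumFields.YangMills.Theorems.FemtoCurvatureTwoPointC.Negative.NearestNeighbourFloorDegenerate

end
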